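import Mathlib
import Summits.ValiantsHypothesis.ValiantsHypothesis.Theorems.RigidityForcesSymmetryRankRigidMinimalReprLaplaceFiveSeparatedCaptureKernelSlice

/-!
# ValiantsHypothesis / RigidityForcesSymmetry — crux `LaplaceOptimalFive` (stmt-ValiantsHypothesis-24813), symmetric capture (SC):
# ★★ **THE HUB-WITH-DIAGONAL COUNT FOR A LINE SLOT: `finrank W ≤ finrank (U₀₁ ⊔ U₀₂ ⊔ U₁₂) + 2` whenever `U₀₁ = ℂu` with
# `u` having three non-zero rows** — in general `finrank W + #{non-zero rows of u} ≤ finrank X + 5` — hence ★★★ `(SC)` WHENEVER ONE SLOT IS A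
# LINE `ℂu` WITH NO ZERO ROW (any other spans), and ★★ `(SC)` for equal lines inside the third span for EVERY finrank (`u ∈ V` with ≥ 3 non-zero rows)

From the joint-prolongation residue (✓ `sub_symPlaced_mem_prolong`) with a line slot `U₀₁ = ℂu`, `A_r = a_r u`: for every vector `z`
the `z`-slice of an obligation is `(a·z) u + a ⊙ ℓ + Σ_r z_r G_r`, `ℓ := u z` (`sliceZ_mem_line_01`), so it lies in
`X ⊔ span{e_i ⊙ ℓ}` (`X = U₀₁ ⊔ U₀₂ ⊔ U₁₂`) AND has zero diagonal (the obligation is square-free).  For `z` with all coordinates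
non-zero the `z`-slice is injective on obligations (✓ `eq_zero_of_sliceZ`), and the diagonal map has rank ≥ 3 on `span{e_i ⊙ ℓ}` as soon as
`ℓ` has three non-zero coordinates; such `z` exists for any set `S` of non-zero rows (`exists_fullSupport_rows`, Mathlib's «a vector space over an infinite field is not a
finite union of proper subspaces»).  Hence ★★★ `finrank_add_card_le_of_line_rows`: `finrank W + |S| ≤ finrank X + 5`.  Consequences:
★★★ `captureIneqSym_of_line_noZeroRow` — `U₀₁ = ℂu` with every row of `u` non-zero ⇒ `(SC)` for ALL `U₀₂, U₁₂` (any finranks, any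
position); ★★ `captureIneqSym_of_equal_lines_mem_rows` — `(ℂu, ℂu, V)`, `u ∈ V` with three non-zero
rows, `V` symmetric of ANY finrank ⇒ `(SC)` (here `X = V`, `D = finrank V + 2`); `captureIneqSym_of_line_rows_of_le` — the bookkeeping
form `finrank X + 2 ≤ Σ finrank` (e.g. a line with three non-zero rows lying in `U₀₂ ⊓ U₁₂`-overlapping configurations).
Located (seat census, exact): the remaining `(1,1,r)`, `r ≥ 4`, equal-lines cases (`u ∉ V`; `u ∈ V` pair-supported) are
(L1) «a line adds ≤ 3 square-free dimensions over `prolong X`» + (L2) «`finrank (SF ∩ prolong X) ≤ finrank X − 2`», both 0 violations.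

Honest framing.  Sub-families of an OPEN inequality: `CaptureIneqSym` in general, K1 on `K₃ ⊔ K₂`, S2′, `LaplaceOptimalFive`
(stmt-24813, OPEN · CONTESTED 72/120), `RankRigidMinimalRepr`, `VP ≠ VNP` are NOT proved.  No definitions, no `sorry`; Mathlib + tree only.
-/

set_option linter.dupNamespace false
set_option autoImplicit false

namespace Summit.ValiantsHypothesis.ValiantsHypothesis.Theorems.RigidityForcesSymmetryRankRigidMinimalRepr

namespace LaplaceFiveSeparatedCapture

open Finset LaplaceFiveSectorSplit

/-! ### A fully supported test vector seeing a set of non-zero rows -/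

/-- If the rows `p ∈ S` of `u` are non-zero, some vector `z` with all coordinates non-zero has `(u z)_p ≠ 0` for every `p ∈ S`
(a complex vector space is not a finite union of proper subspaces). [folklore] -/
theorem exists_fullSupport_rows (u : Fin 5 → Fin 5 → ℂ) (S : Finset (Fin 5)) (hS : ∀ p ∈ S, ∃ q, u p q ≠ 0) :
    ∃ z : Fin 5 → ℂ, (∀ c, z c ≠ 0) ∧ ∀ p ∈ S, (∑ q, u p q * z q) ≠ 0 := by
  classical
  let row : Fin 5 → Module.Dual ℂ (Fin 5 → ℂ) := fun p => ∑ q : Fin 5, u p q • (LinearMap.proj q : (Fin 5 → ℂ) →ₗ[ℂ] ℂ)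
  have hrow : ∀ p (z : Fin 5 → ℂ), row p z = ∑ q, u p q * z q := by
    intro p z
    simp only [row, LinearMap.coe_sum, Finset.sum_apply, LinearMap.smul_apply, LinearMap.coe_proj, Function.eval,
      smul_eq_mul]
  let f : Fin 5 ⊕ S → Module.Dual ℂ (Fin 5 → ℂ) := fun i =>
    match i with
    | Sum.inl c => (LinearMap.proj c : (Fin 5 → ℂ) →ₗ[ℂ] ℂ)
    | Sum.inr k => row k.1
  have hf : ∀ i, ∃ x, f i x ≠ 0 := by
    rintro (c | ⟨k, hk⟩)
    · refine ⟨fun j => if j = c then 1 else 0, ?_⟩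
      simp [f]
    · obtain ⟨q, hq⟩ := hS k hk
      refine ⟨fun j => if j = q then 1 else 0, ?_⟩
      show row _ _ ≠ 0
      rw [hrow]
      simp only [mul_ite, mul_one, mul_zero, Finset.sum_ite_eq', Finset.mem_univ, if_true]
      exact hq
  obtain ⟨z, hz⟩ := Module.Dual.exists_forall_ne_zero_of_forall_exists f hf
  refine ⟨z, fun c => hz (Sum.inl c), fun p hp => ?_⟩
  have := hz (Sum.inr ⟨p, hp⟩)
  simp only [f] at this
  rwa [hrow] at this

/-! ### The `z`-slice of an obligation with a line in the slot `01` -/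

/-- ★ **`z`-SLICE WITH A LINE SLOT.**  `U₀₁ = ℂu`: for every captured `μ` and every `z`, the `z`-slice of `P₅⌞μ` is
`s • u + a ⊙ (u z) + x` with `x ∈ U₀₁ ⊔ U₀₂ ⊔ U₁₂`; in particular it lies in `(U₀₁ ⊔ U₀₂ ⊔ U₁₂) ⊔ span {e_i ⊙ (u z)}`. [folklore] -/
theorem sliceZ_mem_line_01 (u : Fin 5 → Fin 5 → ℂ) (hu : ∀ p q, u p q = u q p) (U02 U12 : Submodule ℂ (Fin 5 → Fin 5 → ℂ))
    (h02 : ∀ x ∈ U02, ∀ p q : Fin 5, x p q = x q p) (h12 : ∀ x ∈ U12, ∀ p q : Fin 5, x p q = x q p)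
    (z : Fin 5 → ℂ) (μ : Fin 5 → Fin 5 → ℂ) (hμ : contractZ μ ∈ L3 (ℂ ∙ u) U02 U12) :
    (fun p q => ∑ r : Fin 5, z r * contractZ μ p q r) ∈
      ((ℂ ∙ u) ⊔ U02 ⊔ U12) ⊔ Submodule.span ℂ (Set.range fun i : Fin 5 => fun p q : Fin 5 =>
        (if p = i then (1 : ℂ) else 0) * (∑ r, u q r * z r) + (if q = i then (1 : ℂ) else 0) * (∑ r, u p r * z r)) := by
  classical
  have h01 : ∀ x ∈ (ℂ ∙ u), ∀ p q : Fin 5, x p q = x q p := by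
    intro x hx p q
    obtain ⟨s, rfl⟩ := Submodule.mem_span_singleton.mp hx
    simp only [Pi.smul_apply, smul_eq_mul, hu p q]
  obtain ⟨A, B, C, hA, hB, hC, hT⟩ := L3_finite_form (ℂ ∙ u) U02 U12 hμ
  have hres := (sub_symPlaced_mem_prolong (ℂ ∙ u) U02 U12 A B C (contractZ μ) hA hB hC
    (fun r p q => h01 _ (hA r) p q) (fun r p q => h02 _ (hB r) p q) (fun r p q => h12 _ (hC r) p q) hT
    (fun p q r => contractZ_swap12 μ p q r) (fun p q r => contractZ_swap23 μ p q r)).2.2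
  have hsl := sliceZ_mem_of_mem_prolong _ hres z
  -- `A_r = a_r • u`
  have ha : ∀ r, ∃ s : ℂ, s • u = A r := fun r => Submodule.mem_span_singleton.mp (hA r)
  choose a ha using ha
  set ℓ : Fin 5 → ℂ := fun p => ∑ r, u p r * z r with hℓ
  have e : (fun p q => ∑ r : Fin 5, z r * contractZ μ p q r)
      = (fun p q => ∑ r : Fin 5, z r * (contractZ μ - fun p q r => A r p q + A q p r + A p q r) p q r)
        + ((∑ r : Fin 5, z r * a r) • u
        + ∑ i : Fin 5, a i • (fun p q : Fin 5 =>
            (if p = i then (1 : ℂ) else 0) * (∑ r, u q r * z r) + (if q = i then (1 : ℂ) else 0) * (∑ r, u p r * z r))) := by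
    funext p q
    simp only [Pi.add_apply, Pi.sub_apply, Finset.sum_apply, Pi.smul_apply, smul_eq_mul]
    have eA : ∀ x y w : Fin 5, A x y w = a x * u y w := fun x y w => by
      have := congrFun (congrFun (ha x) y) w
      simpa [Pi.smul_apply, smul_eq_mul] using this.symm
    simp only [eA]
    have e1 : (∑ r : Fin 5, z r * (contractZ μ p q r - (a r * u p q + a q * u p r + a p * u q r)))
        = (∑ r : Fin 5, z r * contractZ μ p q r) - (∑ r : Fin 5, z r * a r) * u p q
          - a q * (∑ r : Fin 5, u p r * z r) - a p * (∑ r : Fin 5, u q r * z r) := by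
      rw [Finset.sum_mul, Finset.mul_sum, Finset.mul_sum, ← Finset.sum_sub_distrib, ← Finset.sum_sub_distrib,
        ← Finset.sum_sub_distrib]
      exact Finset.sum_congr rfl fun r _ => by ring
    have e2 : (∑ i : Fin 5, a i * ((if p = i then (1 : ℂ) else 0) * (∑ r, u q r * z r) + (if q = i then (1 : ℂ) else 0) * (∑ r, u p r * z r)))
        = a p * (∑ r, u q r * z r) + a q * (∑ r, u p r * z r) := by
      simp only [mul_add, Finset.sum_add_distrib, mul_ite, mul_zero, ite_mul, zero_mul, one_mul,
        Finset.sum_ite_eq, Finset.mem_univ, if_true]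
    rw [e1, e2]
    ring
  rw [e]
  refine Submodule.add_mem _ (Submodule.mem_sup_left hsl) (Submodule.add_mem _ ?_ ?_)
  · exact Submodule.mem_sup_left (Submodule.mem_sup_left (Submodule.mem_sup_left
      (Submodule.smul_mem _ _ (Submodule.mem_span_singleton_self u))))
  · exact Submodule.mem_sup_right (Submodule.sum_mem _ fun i _ =>
      Submodule.smul_mem _ _ (Submodule.subset_span ⟨i, rfl⟩))

/-! ### The count: joint span plus the five `e_i ⊙ ℓ`, cut by the zero diagonal -/

/-- ★★★ **HUB-WITH-DIAGONAL COUNT FOR A LINE SLOT.**  `U₀₁ = ℂu`, `U₀₂, U₁₂` symmetric of ANY finrank; if the rows `p ∈ S` of `u`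
are non-zero then `finrank W + |S| ≤ finrank (ℂu ⊔ U₀₂ ⊔ U₁₂) + 5`. [folklore] -/
theorem finrank_add_card_le_of_line_rows (u : Fin 5 → Fin 5 → ℂ) (hu : ∀ p q, u p q = u q p)
    (S : Finset (Fin 5)) (hS : ∀ p ∈ S, ∃ q, u p q ≠ 0)
    (U02 U12 W : Submodule ℂ (Fin 5 → Fin 5 → ℂ))
    (hs02 : ∀ x ∈ U02, ∀ p q : Fin 5, x p q = x q p) (hs12 : ∀ x ∈ U12, ∀ p q : Fin 5, x p q = x q p)
    (hWs : ∀ μ ∈ W, ∀ s t : Fin 5, μ s t = μ t s) (hWd : ∀ μ ∈ W, ∀ s : Fin 5, μ s s = 0)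
    (hWc : ∀ μ ∈ W, contractZ μ ∈ L3 (ℂ ∙ u) U02 U12) :
    Module.finrank ℂ W + S.card ≤ Module.finrank ℂ ((ℂ ∙ u) ⊔ U02 ⊔ U12 : Submodule ℂ (Fin 5 → Fin 5 → ℂ)) + 5 := by
  classical
  obtain ⟨z, hz, hzS⟩ := exists_fullSupport_rows u S hS
  set X : Submodule ℂ (Fin 5 → Fin 5 → ℂ) := (ℂ ∙ u) ⊔ U02 ⊔ U12 with hXdef
  set ℓ : Fin 5 → ℂ := fun p => ∑ r, u p r * z r with hℓ
  let E : Fin 5 → (Fin 5 → Fin 5 → ℂ) := fun i p q =>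
    (if p = i then (1 : ℂ) else 0) * (∑ r, u q r * z r) + (if q = i then (1 : ℂ) else 0) * (∑ r, u p r * z r)
  set L5 : Submodule ℂ (Fin 5 → Fin 5 → ℂ) := Submodule.span ℂ (Set.range E) with hL5
  -- the diagonal map
  let Dg : (Fin 5 → Fin 5 → ℂ) →ₗ[ℂ] (Fin 5 → ℂ) :=
    { toFun := fun M p => M p p, map_add' := fun _ _ => rfl, map_smul' := fun _ _ => rfl }
  have hDg : ∀ (M : Fin 5 → Fin 5 → ℂ) (p : Fin 5), Dg M p = M p p := fun _ _ => rfl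
  -- slices land in `(X ⊔ L5) ⊓ ker Dg`
  have hY : ∀ μ ∈ W, (fun p q => ∑ r : Fin 5, z r * contractZ μ p q r) ∈ (X ⊔ L5) ⊓ LinearMap.ker Dg := by
    intro μ hμ
    refine Submodule.mem_inf.mpr ⟨sliceZ_mem_line_01 u hu U02 U12 hs02 hs12 z μ (hWc μ hμ), ?_⟩
    rw [LinearMap.mem_ker]
    funext p
    rw [hDg, Pi.zero_apply]
    exact Finset.sum_eq_zero fun r _ => by rw [contractZ_rep12 μ p r, mul_zero]
  have hW := finrank_le_of_sliceZ_mem W ((X ⊔ L5) ⊓ LinearMap.ker Dg) hWs hWd z hz hY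
  -- rank–nullity for `Dg` on `X ⊔ L5`
  have hrn := LinearMap.finrank_range_add_finrank_ker (Dg.domRestrict (X ⊔ L5))
  have hker : Module.finrank ℂ ((X ⊔ L5) ⊓ LinearMap.ker Dg : Submodule ℂ (Fin 5 → Fin 5 → ℂ))
      = Module.finrank ℂ (LinearMap.ker (Dg.domRestrict (X ⊔ L5))) := by
    rw [LinearMap.ker_domRestrict, ← Submodule.finrank_map_subtype_eq (X ⊔ L5), Submodule.map_comap_subtype, inf_comm]
  -- the range contains the independent coordinate vectors `2 ℓ_p • e_p`, `p ∈ S`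
  have hmemE : ∀ i, E i ∈ X ⊔ L5 := fun i => Submodule.mem_sup_right (Submodule.subset_span ⟨i, rfl⟩)
  have hDE : ∀ i, Dg (E i) = (2 * ∑ r, u i r * z r) • (Pi.single i (1 : ℂ) : Fin 5 → ℂ) := by
    intro i
    funext p
    rw [hDg, Pi.smul_apply, smul_eq_mul, Pi.single_apply]
    show (if p = i then (1 : ℂ) else 0) * (∑ r, u p r * z r) + (if p = i then (1 : ℂ) else 0) * (∑ r, u p r * z r) = _
    by_cases h : p = i
    · rw [if_pos h, h]; ring
    · rw [if_neg h]; ring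
  have hℓ2 : ∀ p ∈ S, (2 : ℂ) * ∑ r, u p r * z r ≠ 0 := fun p hp => mul_ne_zero two_ne_zero (hzS p hp)
  have hcard : S.card ≤ Module.finrank ℂ (LinearMap.range (Dg.domRestrict (X ⊔ L5))) := by
    let v : S → LinearMap.range (Dg.domRestrict (X ⊔ L5)) := fun k =>
      ⟨Dg (E k.1), ⟨⟨E _, hmemE _⟩, rfl⟩⟩
    have hli : LinearIndependent ℂ v := by
      rw [Fintype.linearIndependent_iff]
      intro c hc k₀
      have e := congrArg (fun w : LinearMap.range (Dg.domRestrict (X ⊔ L5)) => (w : Fin 5 → ℂ) k₀.1) hc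
      simp only [Submodule.coe_sum, Submodule.coe_smul, Finset.sum_apply, Pi.smul_apply, smul_eq_mul,
        Submodule.coe_zero, Pi.zero_apply, v, hDE, Pi.single_apply] at e
      rw [Finset.sum_eq_single k₀] at e
      · simp only [if_true] at e
        have : c k₀ * ((2 : ℂ) * ∑ r, u k₀.1 r * z r) = 0 := by
          simpa [mul_comm, mul_assoc, mul_left_comm] using e
        exact (mul_eq_zero.mp this).resolve_right (hℓ2 k₀.1 k₀.2)
      · intro k _ hk
        have hne : (k₀.1 : Fin 5) ≠ k.1 := fun h => hk (Subtype.ext h.symm)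
        rw [if_neg hne]; ring
      · intro h; exact absurd (Finset.mem_univ k₀) h
    have := hli.fintype_card_le_finrank
    simpa using this
  -- `finrank (X ⊔ L5) ≤ finrank X + 5`
  have hL5le : Module.finrank ℂ L5 ≤ 5 := by
    have := finrank_span_le_card (R := ℂ) (Set.range E)
    refine this.trans ?_
    rw [Set.toFinset_range]
    exact (Finset.card_image_le).trans (by simp)
  have hsup : Module.finrank ℂ (X ⊔ L5 : Submodule ℂ (Fin 5 → Fin 5 → ℂ)) ≤ Module.finrank ℂ X + 5 :=
    (Submodule.finrank_add_le_finrank_add_finrank _ _).trans (by omega)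
  rw [hker] at hW
  omega

/-- ★★★ **`(SC)` FOR A LINE WITHOUT ZERO ROWS**: if `U₀₁ = ℂu` with EVERY row of `u` non-zero (e.g. `u` of full rank), then for
`U₀₂, U₁₂` symmetric of ANY finranks and ANY position, `finrank W ≤ finrank (ℂu ⊔ U₀₂ ⊔ U₁₂) ≤ finrank ℂu + finrank U₀₂ + finrank U₁₂`.
[folklore] -/
theorem captureIneqSym_of_line_noZeroRow (u : Fin 5 → Fin 5 → ℂ) (hu : ∀ p q, u p q = u q p)
    (hrows : ∀ p : Fin 5, ∃ q, u p q ≠ 0) (U02 U12 W : Submodule ℂ (Fin 5 → Fin 5 → ℂ))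
    (hs02 : ∀ x ∈ U02, ∀ p q : Fin 5, x p q = x q p) (hs12 : ∀ x ∈ U12, ∀ p q : Fin 5, x p q = x q p)
    (hWs : ∀ μ ∈ W, ∀ s t : Fin 5, μ s t = μ t s) (hWd : ∀ μ ∈ W, ∀ s : Fin 5, μ s s = 0)
    (hWc : ∀ μ ∈ W, contractZ μ ∈ L3 (ℂ ∙ u) U02 U12) :
    Module.finrank ℂ W ≤ Module.finrank ℂ (ℂ ∙ u) + Module.finrank ℂ U02 + Module.finrank ℂ U12 := by
  have h := finrank_add_card_le_of_line_rows u hu Finset.univ (fun p _ => hrows p) U02 U12 W hs02 hs12 hWs hWd hWc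
  rw [Finset.card_univ, Fintype.card_fin] at h
  have hX : Module.finrank ℂ ((ℂ ∙ u) ⊔ U02 ⊔ U12 : Submodule ℂ (Fin 5 → Fin 5 → ℂ))
      ≤ Module.finrank ℂ (ℂ ∙ u) + Module.finrank ℂ U02 + Module.finrank ℂ U12 :=
    (Submodule.finrank_add_le_finrank_add_finrank _ _).trans
      (Nat.add_le_add_right (Submodule.finrank_add_le_finrank_add_finrank _ _) _)
  omega

/-- ★★ **`(SC)` FOR EQUAL LINES INSIDE THE THIRD SPAN, ANY FINRANK**: `(ℂu, ℂu, V)` with `u ∈ V` having at least three non-zero rows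
(`p₁, p₂, p₃` distinct) and `V` symmetric of ANY finrank ⇒ `finrank W ≤ finrank ℂu + finrank ℂu + finrank V`. [folklore] -/
theorem captureIneqSym_of_equal_lines_mem_rows (u : Fin 5 → Fin 5 → ℂ) (hu : ∀ p q, u p q = u q p) (hu0 : u ≠ 0)
    (p₁ p₂ p₃ : Fin 5) (h12 : p₁ ≠ p₂) (h13 : p₁ ≠ p₃) (h23 : p₂ ≠ p₃)
    (hr₁ : ∃ q, u p₁ q ≠ 0) (hr₂ : ∃ q, u p₂ q ≠ 0) (hr₃ : ∃ q, u p₃ q ≠ 0)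
    (V W : Submodule ℂ (Fin 5 → Fin 5 → ℂ)) (hV : ∀ x ∈ V, ∀ p q : Fin 5, x p q = x q p) (huV : u ∈ V)
    (hWs : ∀ μ ∈ W, ∀ s t : Fin 5, μ s t = μ t s) (hWd : ∀ μ ∈ W, ∀ s : Fin 5, μ s s = 0)
    (hWc : ∀ μ ∈ W, contractZ μ ∈ L3 (ℂ ∙ u) (ℂ ∙ u) V) :
    Module.finrank ℂ W ≤ Module.finrank ℂ (ℂ ∙ u) + Module.finrank ℂ (ℂ ∙ u) + Module.finrank ℂ V := by
  classical
  have h01 : ∀ x ∈ (ℂ ∙ u), ∀ p q : Fin 5, x p q = x q p := by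
    intro x hx p q
    obtain ⟨s, rfl⟩ := Submodule.mem_span_singleton.mp hx
    simp only [Pi.smul_apply, smul_eq_mul, hu p q]
  have hle : (ℂ ∙ u) ≤ V := (Submodule.span_singleton_le_iff_mem u V).mpr huV
  have hXeq : (ℂ ∙ u) ⊔ (ℂ ∙ u) ⊔ V = V := by rw [sup_idem, sup_eq_right.mpr hle]
  have hS3 : ({p₁, p₂, p₃} : Finset (Fin 5)).card = 3 := by
    rw [Finset.card_insert_of_notMem (by simp [h12, h13]), Finset.card_insert_of_notMem (by simp [h23]),
      Finset.card_singleton]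
  have h := finrank_add_card_le_of_line_rows u hu {p₁, p₂, p₃} (fun p hp => by
      simp only [Finset.mem_insert, Finset.mem_singleton] at hp
      rcases hp with rfl | rfl | rfl
      · exact hr₁
      · exact hr₂
      · exact hr₃) (ℂ ∙ u) V W h01 hV hWs hWd hWc
  rw [hXeq, hS3] at h
  rw [finrank_span_singleton hu0]
  omega

/-- ★ **BOOKKEEPING FORM**: a line slot `ℂu` with non-zero rows `p ∈ S` and
`finrank (ℂu ⊔ U₀₂ ⊔ U₁₂) + 5 ≤ 1 + finrank U₀₂ + finrank U₁₂ + |S|` ⇒ `(SC)`. [folklore] -/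
theorem captureIneqSym_of_line_rows_of_le (u : Fin 5 → Fin 5 → ℂ) (hu : ∀ p q, u p q = u q p) (hu0 : u ≠ 0)
    (S : Finset (Fin 5)) (hS : ∀ p ∈ S, ∃ q, u p q ≠ 0)
    (U02 U12 W : Submodule ℂ (Fin 5 → Fin 5 → ℂ))
    (hs02 : ∀ x ∈ U02, ∀ p q : Fin 5, x p q = x q p) (hs12 : ∀ x ∈ U12, ∀ p q : Fin 5, x p q = x q p)
    (hX : Module.finrank ℂ ((ℂ ∙ u) ⊔ U02 ⊔ U12 : Submodule ℂ (Fin 5 → Fin 5 → ℂ)) + 5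
      ≤ 1 + Module.finrank ℂ U02 + Module.finrank ℂ U12 + S.card)
    (hWs : ∀ μ ∈ W, ∀ s t : Fin 5, μ s t = μ t s) (hWd : ∀ μ ∈ W, ∀ s : Fin 5, μ s s = 0)
    (hWc : ∀ μ ∈ W, contractZ μ ∈ L3 (ℂ ∙ u) U02 U12) :
    Module.finrank ℂ W ≤ Module.finrank ℂ (ℂ ∙ u) + Module.finrank ℂ U02 + Module.finrank ℂ U12 := by
  have h := finrank_add_card_le_of_line_rows u hu S hS U02 U12 W hs02 hs12 hWs hWd hWc
  rw [finrank_span_singleton hu0]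
  omega

end LaplaceFiveSeparatedCapture

end Summit.ValiantsHypothesis.ValiantsHypothesis.Theorems.RigidityForcesSymmetryRankRigidMinimalRepr
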